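import Summits.Ventures.PackingBounds.Configurations.DesignSlackness

/-!
# Per-point Gegenbauer moments vanish at an LP-sharp code (every degree `k` with `f_k > 0`)

Framing: lottery ticket; floor = certified bounds/negative ranges. Venture `PackingBounds`
(cell `pub-packcert`), spherical-code family; general form of the per-point identities used in the
`L − 1` rows (`DegreeThreeEquality`: `k = 1`, balanced; `DegreeFourEquality`: `k = 2`, 2-design),
obtained by composing the design half of complementary slackness
(`Literature…DelsarteLP.sum_sum_gegenbauerSum_eq_zero_of_card_mul_eq_coord`: total moment zero) with
`Config.DesignSlackness.pointMoment_eq_zero_of_total` (PSD kernel: total zero ⇒ every row zero).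

**Theorem.** If `C ⊂ S^{n-1}` (`n = 2μ+2`, `μ > 0`) with pairwise inner products `≤ s` attains the LP bound
`|C| f_0 = f(1)` for an admissible `f` of degree `d`, then for every `1 ≤ k ≤ d` with `f_k > 0`:
`Σ_{x,y ∈ C} C_k^{μ}(⟨x,y⟩) = 0` (`sum_sum_gegenbauerSum_eq_zero_of_card_mul_eq`, `Finset` form) and
`Σ_{y ∈ C} C_k^{μ}(⟨x,y⟩) = 0` for every `x ∈ C` (`sum_gegenbauerSum_eq_zero_of_card_mul_eq`).
(Delsarte–Goethals–Seidel 1977; Bannai–Sloane 1981.)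

## References
* P. Delsarte, J. M. Goethals, J. J. Seidel, *Spherical codes and designs*, Geom. Dedicata 6 (1977)
  363–388. [`DelsarteGoethalsSeidel1977`]
* J. H. Conway, N. J. A. Sloane, *SPLAG*, Ch. 14 (Bannai–Sloane). [`ConwaySloane1999`]
-/

noncomputable section

namespace Summit.Ventures.PackingBounds.SphericalCodes

open Finset Literature.Analysis.SpecialFunctions Literature.Geometry.DiscreteGeometry
open scoped RealInnerProductSpace

/-- **Total Gegenbauer moments vanish at an LP-sharp code** (`Finset` form of the design half of
complementary slackness): under the LP hypotheses with `|C| f_0 = f(1)`, for every `1 ≤ k ≤ d` with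
`f_k > 0`, `Σ_{x ∈ C} Σ_{y ∈ C} C_k^{μ}(⟨x, y⟩) = 0`. (Delsarte–Goethals–Seidel 1977 §4; Bannai–Sloane.) -/
theorem sum_sum_gegenbauerSum_eq_zero_of_card_mul_eq {n : ℕ} {μ : ℝ} (hn : (n : ℝ) = 2 * μ + 2)
    (hμ : 0 < μ) (d : ℕ) (f : ℕ → ℝ) (hf : ∀ k, 0 ≤ f k) (s : ℝ)
    (hF : ∀ t : ℝ, -1 ≤ t → t ≤ s → ∑ k ∈ range (d + 1), f k * gegenbauerSum μ k t ≤ 0)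
    (C : Finset (EuclideanSpace ℝ (Fin n))) (h1 : ∀ x ∈ C, ‖x‖ = 1)
    (h2 : ∀ x ∈ C, ∀ y ∈ C, x ≠ y → inner ℝ x y ≤ s)
    (heq : (C.card : ℝ) * f 0 = ∑ k ∈ range (d + 1), f k * gegenbauerSum μ k 1)
    {k : ℕ} (hkd : k ≤ d) (hk1 : 1 ≤ k) (hfk : 0 < f k) :
    ∑ x ∈ C, ∑ y ∈ C, gegenbauerSum μ k (inner ℝ x y) = 0 := by
  classical
  have hinner : ∀ a b : EuclideanSpace ℝ (Fin n), inner ℝ a b = ∑ j, a j * b j := fun a b => by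
    simp [PiLp.inner_apply, mul_comm]
  set xs : C → Fin n → ℝ := fun a j => (a : EuclideanSpace ℝ (Fin n)) j with hxs
  have hunit : ∀ a : C, ∑ j, xs a j ^ 2 = 1 := fun a => by
    rw [← EuclideanSpace.real_norm_sq_eq, h1 a a.2, one_pow]
  have hsep : ∀ a b : C, a ≠ b → ∑ j, xs a j * xs b j ≤ s := fun a b hab => by
    have hne : (a : EuclideanSpace ℝ (Fin n)) ≠ b := fun h => hab (Subtype.ext h)
    have h := h2 a a.2 b b.2 hne
    rwa [hinner] at h
  have heq' : (Fintype.card C : ℝ) * f 0 = ∑ k ∈ range (d + 1), f k * gegenbauerSum μ k 1 := by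
    simpa [Fintype.card_coe] using heq
  have htot := DelsarteLP.sum_sum_gegenbauerSum_eq_zero_of_card_mul_eq_coord hn hμ d f hf s hF xs
    hunit hsep heq' (k := k) (Finset.mem_range.2 (by omega)) hk1 hfk
  rw [← Finset.sum_coe_sort C]
  have : ∀ a : C, ∑ y ∈ C, gegenbauerSum μ k (inner ℝ (a : EuclideanSpace ℝ (Fin n)) y) =
      ∑ b : C, gegenbauerSum μ k (∑ j, xs a j * xs b j) := by
    intro a
    rw [← Finset.sum_coe_sort C]
    exact Finset.sum_congr rfl fun b _ => by rw [hinner]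
  rw [Finset.sum_congr rfl fun a _ => this a]
  exact htot

/-- **Per-point design identities at an LP-sharp code.** Under the LP hypotheses with `|C| f_0 = f(1)`,
for every `1 ≤ k ≤ d` with `f_k > 0` and every `x ∈ C`: `Σ_{y ∈ C} C_k^{μ}(⟨x, y⟩) = 0` (total moment
zero + positive semidefiniteness of the Gegenbauer kernel, `Config.DesignSlackness`). With valency
unknowns these are the linear equations behind the classical distance-distribution integrality tests
(Boyvalenkov–Landgev 1995). (Delsarte–Goethals–Seidel 1977; Bannai–Sloane 1981.) -/
theorem sum_gegenbauerSum_eq_zero_of_card_mul_eq {n : ℕ} {μ : ℝ} (hn : (n : ℝ) = 2 * μ + 2)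
    (hμ : 0 < μ) (d : ℕ) (f : ℕ → ℝ) (hf : ∀ k, 0 ≤ f k) (s : ℝ)
    (hF : ∀ t : ℝ, -1 ≤ t → t ≤ s → ∑ k ∈ range (d + 1), f k * gegenbauerSum μ k t ≤ 0)
    (C : Finset (EuclideanSpace ℝ (Fin n))) (h1 : ∀ x ∈ C, ‖x‖ = 1)
    (h2 : ∀ x ∈ C, ∀ y ∈ C, x ≠ y → inner ℝ x y ≤ s)
    (heq : (C.card : ℝ) * f 0 = ∑ k ∈ range (d + 1), f k * gegenbauerSum μ k 1)
    {k : ℕ} (hkd : k ≤ d) (hk1 : 1 ≤ k) (hfk : 0 < f k)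
    {x : EuclideanSpace ℝ (Fin n)} (hx : x ∈ C) :
    ∑ y ∈ C, gegenbauerSum μ k (inner ℝ x y) = 0 :=
  Config.DesignSlackness.pointMoment_eq_zero_of_total hn hμ C h1 k
    (sum_sum_gegenbauerSum_eq_zero_of_card_mul_eq hn hμ d f hf s hF C h1 h2 heq hkd hk1 hfk) hx

end Summit.Ventures.PackingBounds.SphericalCodes

end
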